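import Literature.Geometry.Lorentzian.HarmonicallyFlatProofs
import Literature.Analysis.PDE.PoissonKernelBall
import HarnessLib

/-!
# The Kelvin transform of a function harmonic at infinity is smooth and harmonic across the origin
# (Folland, Thm. (2.73) and Prop. (2.74), `n = 3`; the "removable singularity" sentence of
# Bray 2001, proof of Thm. 8)

Folland, *Introduction to Partial Differential Equations* (2nd ed.), §2.I: the **Kelvin transform**
of a function `u` on `Ω ⊆ ℝⁿ ∖ {0}` is `ũ(y) = |y|^{2-n} u(|y|⁻² y)`; Thm. (2.73): *if `u` is
harmonic on `Ω`, its Kelvin transform is harmonic on `Ω̃`*; Prop. (2.74): *if `u` is harmonic on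
the complement of a bounded set in `ℝⁿ`, `n > 2`, then `u` is harmonic at infinity (i.e. `ũ` has a
removable singularity at `0`) iff `u(x) → 0` as `x → ∞` iff `|u(x)| = O(|x|^{2-n})`*. This is the
step of Bray, J. Differential Geom. 59 (2001), §6, proof of Thm. 8: *"the metric `g̃ = φ⁴ḡ` in
each end is conformal to a punctured ball with the conformal factor being a bounded harmonic
function to the fourth power in the punctured ball. Hence, by the removable singularity theorem,
this harmonic function can be extended to the whole ball, which proves that the metric `g̃` can be
extended smoothly over all of the points at infinity"* — in a harmonically flat end `ḡ = 𝒰⁴δ`,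
`φ → 0`, the function `V = 𝒰 φ` is flat-harmonic and tends to `0`, `g̃ = V⁴ δ_x`, and in the
inverted coordinate `y = x/|x|²` (`δ_x = |y|⁻⁴ δ_y`) one has `g̃ = W(y)⁴ δ_y` with
`W(y) = |y|⁻¹ V(|y|⁻² y)` the Kelvin transform of `V`.

Here (dimension `3`, the case the tree needs) the direction (b) ⇒ (a) of Prop. (2.74) together
with Thm. (2.73) is proved in the following concrete form
(`exists_contDiff_kelvinTransform_of_harmonicOnNhd`): if `V` is harmonic on `{R₁ < |x|} ⊆ ℝ³`
and `V → 0` at infinity, there is a **globally `C^∞` function `W : ℝ³ → ℝ`, harmonic on a ball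
`B(0, ρ)`**, which on the punctured ball `0 < |y| < ρ` equals the Kelvin transform
`|y|⁻¹ V(|y|⁻² y)`, and whose value at the origin is the monopole coefficient `b` of the expansion
`V = b/|x| + O(|x|⁻²)` (`HasHarmonicExpansion V 0 b`, Bray's (10)/(87)).

## The proof (Green's representation instead of a removable-singularity theorem)

Mathlib has neither the mean value property nor removable singularities for harmonic functions on
`ℝⁿ`, so Folland's route (Thm. (2.69)) is not available. Instead, exactly as in
`HarmonicallyFlatProofs.lean` / `HarmonicallyFlatGradientProofs.lean`: cut `V` off near the hole,
`W₀ = (1 - θ) V ∈ C²(ℝ³)`, `f = ΔW₀ ∈ C_c(ℝ³)` supported in `|z| ≤ S`; Green's representation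
(`eq_integral_newtonKernel_mul_laplacian`) gives `V(x) = ∫ Γ(x - z) f(z) dz` for `|x| > S`,
`Γ(w) = -(4π|w|)⁻¹`. **Inversion in the unit sphere** turns the kernel into a function smooth in
`y` *through the origin*: for `x = |y|⁻² y`,
`|y| · |x - z| = | y/|y| - |y| z | = (1 - 2⟨y, z⟩ + |y|²|z|²)^{1/2}`
(`norm_sq_mul_norm_inversion_sub_sq`), so
`|y|⁻¹ Γ(|y|⁻² y - z) = -(4π)⁻¹ (1 - 2⟨y, z⟩ + |y|²|z|²)^{-1/2}`
(`inv_norm_mul_newtonKernel_inversion_sub`), a smooth function of `(y, z)` on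
`{|y| < 1/(2S)} × {|z| ≤ S}`, where the quadratic form is `≥ (1 - |y||z|)² > 1/4`
(`sq_one_sub_mul_norm_le_inversionQuad`). Flooring the quadratic form smoothly at `1/8`
(`Newtonian.smoothFloor`, as in `PoissonKernelBall.lean`) makes the kernel globally smooth without
changing it there, and the smooth-parametric-integral lemmas of `PoissonKernelBall.lean`
(`contDiff_integral_kernel_mul_real`, `laplacian_integral_kernel_mul_real`) give a globally `C^∞`
`W(y) = ∫ A(y, z) (-(4π)⁻¹ f(z)) dz` equal to `|y|⁻¹ V(|y|⁻² y)` on the punctured ball, with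
`W(0) = -(4π)⁻¹ ∫ f = b`. Harmonicity of `W` (Kelvin's theorem (2.73), here only near the origin,
which is all that is used downstream): for `z ≠ 0` the kernel is
`(1 - 2⟨y,z⟩ + |y|²|z|²)^{-1/2} = |z|⁻¹ |y - z*|⁻¹`, `z* = z/|z|²` (`inversionQuad_eq_norm_sq_mul`),
a multiple of the Newtonian kernel centred at the inverted point `z*`, `|z*| ≥ 1/S > |y|`, hence
harmonic in `y` (`laplacian_inversionKernel_eq_zero`); for `z = 0` it is constant.

Everything is proved; nothing is defined and no named fact is introduced.

## References

* G. B. Folland, *Introduction to Partial Differential Equations*, 2nd ed., Princeton University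
  Press (1995), §2.I, (2.72), Thm. (2.73), Prop. (2.74) (book pp. 93–94). [Folland2020]
* H. L. Bray, *Proof of the Riemannian Penrose inequality using the positive mass theorem*,
  J. Differential Geom. 59 (2001) 177–267, §6, proof of Thm. 8 (the removable-singularity
  sentence); §2, (10). [BrayRPI2001]
* D. Gilbarg, N. S. Trudinger, *Elliptic partial differential equations of second order* (2001),
  (2.17) (Green's representation formula). [GilbargTrudinger2001]
-/

noncomputable section

open Set Filter Asymptotics Bornology Metric MeasureTheory Topology InnerProductSpace
open scoped Real Laplacian ContDiff RealInnerProductSpace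

namespace Literature.Geometry.Lorentzian

open Literature.Analysis.FluidPDE Literature.Analysis.PDE

/-! ### Inversion in the unit sphere and the Newtonian kernel -/

/-- **The inversion identity for distances**: for `y ≠ 0` and `x = |y|⁻² y` (the inversion of `y`
in the unit sphere), `|y|² |x - z|² = 1 - 2⟨y, z⟩ + |y|² |z|²` — i.e. `|y| |x - z| = |ŷ - |y| z|`
(Folland, §2.I, the computation before (2.72)). [folklore] -/
theorem norm_sq_mul_norm_inversion_sub_sq {y : E3} (hy : y ≠ 0) (z : E3) :
    ‖y‖ ^ 2 * ‖(‖y‖ ^ 2)⁻¹ • y - z‖ ^ 2 = 1 - 2 * ⟪y, z⟫ + ‖y‖ ^ 2 * ‖z‖ ^ 2 := by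
  have hy0 : ‖y‖ ≠ 0 := norm_ne_zero_iff.2 hy
  rw [norm_sub_sq_real, norm_smul, real_inner_smul_left, Real.norm_eq_abs, abs_inv,
    abs_of_nonneg (by positivity : (0 : ℝ) ≤ ‖y‖ ^ 2)]
  field_simp

/-- **Positivity of the inverted distance**: `(1 - |y||z|)² ≤ 1 - 2⟨y, z⟩ + |y|²|z|²`
(Cauchy–Schwarz), so the quadratic form is `> 1/4` as soon as `|y| |z| < 1/2`. [folklore] -/
theorem sq_one_sub_mul_norm_le_inversionQuad (y z : E3) :
    (1 - ‖y‖ * ‖z‖) ^ 2 ≤ 1 - 2 * ⟪y, z⟫ + ‖y‖ ^ 2 * ‖z‖ ^ 2 := by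
  have h := real_inner_le_norm y z
  nlinarith

/-- The quadratic form exceeds `1/4` when `|y| |z| < 1/2`. [folklore] -/
theorem one_quarter_lt_inversionQuad {y z : E3} (h : ‖y‖ * ‖z‖ < 1 / 2) :
    1 / 4 < 1 - 2 * ⟪y, z⟫ + ‖y‖ ^ 2 * ‖z‖ ^ 2 := by
  have h1 : 1 / 4 < (1 - ‖y‖ * ‖z‖) ^ 2 := by
    nlinarith [mul_pos (by linarith : (0 : ℝ) < 1 / 2 - ‖y‖ * ‖z‖)
      (by linarith : (0 : ℝ) < 3 / 2 - ‖y‖ * ‖z‖)]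
  exact lt_of_lt_of_le h1 (sq_one_sub_mul_norm_le_inversionQuad y z)

/-- **The Kelvin-transformed Newtonian kernel**: for `y ≠ 0`, `x = |y|⁻² y`, and the quadratic
form positive, `|y|⁻¹ Γ(x - z) = -(4π)⁻¹ (1 - 2⟨y, z⟩ + |y|²|z|²)^{-1/2}` (`Γ(w) = -(4π|w|)⁻¹`,
`newtonKernel`): the kernel of the Newtonian potential, read at the inverted point and weighted
by `|y|^{2-n} = |y|⁻¹`, is a smooth function of `(y, z)` through `y = 0` (Folland, §2.I, the
construction before (2.72)–(2.73)). [folklore] -/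
theorem inv_norm_mul_newtonKernel_inversion_sub {y : E3} (hy : y ≠ 0) (z : E3)
    (hq : 0 < 1 - 2 * ⟪y, z⟫ + ‖y‖ ^ 2 * ‖z‖ ^ 2) :
    ‖y‖⁻¹ * newtonKernel ((‖y‖ ^ 2)⁻¹ • y - z) =
      -(4 * π)⁻¹ * (1 - 2 * ⟪y, z⟫ + ‖y‖ ^ 2 * ‖z‖ ^ 2) ^ (-(1 / 2 : ℝ)) := by
  set q : ℝ := 1 - 2 * ⟪y, z⟫ + ‖y‖ ^ 2 * ‖z‖ ^ 2 with hq_def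
  have hy0 : 0 < ‖y‖ := norm_pos_iff.2 hy
  have hid := norm_sq_mul_norm_inversion_sub_sq hy z
  rw [← hq_def] at hid
  -- `|x - z| = √q / |y|`
  have hdist : ‖(‖y‖ ^ 2)⁻¹ • y - z‖ = Real.sqrt q / ‖y‖ := by
    have h1 : (‖y‖ * ‖(‖y‖ ^ 2)⁻¹ • y - z‖) ^ 2 = q := by rw [mul_pow]; exact hid
    have h2 : ‖y‖ * ‖(‖y‖ ^ 2)⁻¹ • y - z‖ = Real.sqrt q := by
      rw [← h1, Real.sqrt_sq (mul_nonneg (norm_nonneg _) (norm_nonneg _))]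
    rw [eq_div_iff hy0.ne', mul_comm]
    exact h2
  have hsq : 0 < Real.sqrt q := Real.sqrt_pos.2 hq
  rw [newtonKernel_eq, hdist, Real.rpow_neg hq.le, ← Real.sqrt_eq_rpow]
  field_simp

/-- **The inverted point**: for `z ≠ 0` and `z* = |z|⁻² z`,
`1 - 2⟨y, z⟩ + |y|²|z|² = |z|² |y - z*|²`, so that the Kelvin-transformed kernel is
`|z|⁻¹ |y - z*|⁻¹`, a multiple of the Newtonian kernel centred at `z*` (Folland, §2.I).
[folklore] -/
theorem inversionQuad_eq_norm_sq_mul {z : E3} (hz : z ≠ 0) (y : E3) :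
    1 - 2 * ⟪y, z⟫ + ‖y‖ ^ 2 * ‖z‖ ^ 2 = ‖z‖ ^ 2 * ‖y - (‖z‖ ^ 2)⁻¹ • z‖ ^ 2 := by
  have hz0 : ‖z‖ ≠ 0 := norm_ne_zero_iff.2 hz
  rw [norm_sub_sq_real, norm_smul, real_inner_smul_right, Real.norm_eq_abs, abs_inv,
    abs_of_nonneg (by positivity : (0 : ℝ) ≤ ‖z‖ ^ 2)]
  field_simp
  ring

/-- **Kelvin's theorem for the kernel** (Folland, Thm. (2.73), for the function `|x - z|⁻¹`): away
from the inverted point the Kelvin-transformed kernel `y ↦ (1 - 2⟨y, z⟩ + |y|²|z|²)^{-1/2}` is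
harmonic in `y`; precisely, if `|y| |z| < 1/2` then
`Δ_y (1 - 2⟨·, z⟩ + |·|²|z|²)^{-1/2} (y) = 0` (for `z = 0` the function is constant; for `z ≠ 0`
it is `|z|⁻¹ |y - z*|⁻¹ = -4π|z|⁻¹ Γ(y - z*)` near `y`, and `|z*| = |z|⁻¹ > |y|`).
[cite: Folland2020, Thm. (2.73)] -/
theorem laplacian_inversionKernel_eq_zero {y z : E3} (h : ‖y‖ * ‖z‖ < 1 / 2) :
    (Δ (fun w : E3 ↦ ((1 - 2 * ⟪w, z⟫ + ‖w‖ ^ 2 * ‖z‖ ^ 2) ^ (-(1 / 2 : ℝ)) : ℝ))) y = 0 := by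
  by_cases hz : z = 0
  · subst hz
    simp only [inner_zero_right, mul_zero, sub_zero, norm_zero, zero_pow two_ne_zero,
      add_zero, Real.one_rpow]
    have hc : HarmonicAt (fun _ : E3 ↦ (1 : ℝ)) y := harmonicAt_const 1
    exact hc.2.eq_of_nhds
  · -- the inverted point `z* = |z|⁻² z`, `|z*| = |z|⁻¹ > |y|`
    set zs : E3 := (‖z‖ ^ 2)⁻¹ • z with hzs
    have hz0 : 0 < ‖z‖ := norm_pos_iff.2 hz
    have hzs_norm : ‖zs‖ = ‖z‖⁻¹ := by
      rw [hzs, norm_smul, Real.norm_eq_abs, abs_inv, abs_of_nonneg (by positivity : (0 : ℝ) ≤ ‖z‖ ^ 2),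
        pow_two, mul_inv, mul_assoc, inv_mul_cancel₀ hz0.ne', mul_one]
    have hfar : ∀ w : E3, ‖w‖ * ‖z‖ < 1 / 2 → w ≠ zs := by
      intro w hw hwz
      have h1 : ‖w‖ * ‖z‖ = 1 := by rw [hwz, hzs_norm, inv_mul_cancel₀ hz0.ne']
      linarith
    have hyzs : y ≠ zs := hfar y h
    -- near `y` the kernel is `-4π |z|⁻¹ Γ(· - z*)`
    have hopen : IsOpen {w : E3 | ‖w‖ * ‖z‖ < 1 / 2} :=
      isOpen_lt (continuous_norm.mul continuous_const) continuous_const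
    have hev : (fun w : E3 ↦ ((1 - 2 * ⟪w, z⟫ + ‖w‖ ^ 2 * ‖z‖ ^ 2) ^ (-(1 / 2 : ℝ)) : ℝ))
        =ᶠ[𝓝 y] fun w : E3 ↦ (-(4 * π) * ‖z‖⁻¹) * newtonKernel (w - zs) := by
      filter_upwards [hopen.mem_nhds h] with w hw
      have hw' : ‖w‖ * ‖z‖ < 1 / 2 := hw
      have hd : 0 < ‖w - zs‖ := norm_pos_iff.2 (sub_ne_zero.2 (hfar w hw'))
      rw [inversionQuad_eq_norm_sq_mul hz w, ← hzs, newtonKernel_eq,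
        Real.rpow_neg (mul_nonneg (sq_nonneg ‖z‖) (sq_nonneg ‖w - zs‖)), ← Real.sqrt_eq_rpow,
        ← mul_pow, Real.sqrt_sq (mul_nonneg (norm_nonneg z) (norm_nonneg (w - zs)))]
      field_simp
    rw [(laplacian_congr_nhds hev).eq_of_nhds]
    have hsub : ContDiffAt ℝ 2 (fun w : E3 ↦ w - zs) y := contDiffAt_id.sub contDiffAt_const
    have hΓc := (contDiffAt_newtonKernel (n := 2) (sub_ne_zero.2 hyzs)).comp y hsub
    have hΓ : ContDiffAt ℝ 2 (fun w : E3 ↦ newtonKernel (w - zs)) y := hΓc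
    have hsmul : (fun w : E3 ↦ (-(4 * π) * ‖z‖⁻¹) * newtonKernel (w - zs)) =
        (-(4 * π) * ‖z‖⁻¹) • fun w : E3 ↦ newtonKernel (w - zs) := by
      funext w
      simp [smul_eq_mul]
    rw [hsmul, laplacian_smul _ hΓ, LoewnerNirenberg.laplacian_translate_sub newtonKernel zs y,
      laplacian_newtonKernel (sub_ne_zero.2 hyzs), smul_zero]

/-! ### The Kelvin transform of a function harmonic at infinity -/

/-- **The Kelvin transform of a function harmonic at infinity extends smoothly and harmonically
across the origin** (Folland, Thm. (2.73) with Prop. (2.74), (b) ⇒ (a), `n = 3`; the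
removable-singularity step of Bray 2001, proof of Thm. 8). Let `V : ℝ³ → ℝ` be harmonic on
`{R₁ < |x|}` with `V(x) → 0` as `|x| → ∞`. Then there are a function `W : ℝ³ → ℝ` of class `C^∞`
on all of `ℝ³`, a radius `ρ > 0` and a real `b` such that

* `W(y) = |y|⁻¹ V(|y|⁻² y)` for `0 < |y| < ρ` (the Kelvin transform `|y|^{2-n} V(|y|⁻² y)`);
* `W` is harmonic on the ball `B(0, ρ)` (origin included);
* `V = b/|x| + O(|x|⁻²)` at infinity (`HasHarmonicExpansion V 0 b`) and `W(0) = b`.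

Proof by Green's representation `V(x) = ∫ Γ(x - z) ΔW₀(z) dz` beyond the support of the cut-off
and inversion of the kernel (module docstring); `b = -(4π)⁻¹ ∫ ΔW₀`.
[cite: Folland2020, Thm. (2.73) and Prop. (2.74)] -/
theorem exists_contDiff_kelvinTransform_of_harmonicOnNhd (R₁ : ℝ) (V : E3 → ℝ)
    (hV : HarmonicOnNhd V {x : E3 | R₁ < ‖x‖}) (hV0 : Tendsto V (cobounded E3) (𝓝 0)) :
    ∃ (W : E3 → ℝ) (ρ b : ℝ), ContDiff ℝ ∞ W ∧ 0 < ρ ∧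
      (∀ y : E3, y ≠ 0 → ‖y‖ < ρ → W y = ‖y‖⁻¹ * V ((‖y‖ ^ 2)⁻¹ • y)) ∧
      HarmonicOnNhd W (ball (0 : E3) ρ) ∧ HasHarmonicExpansion V 0 b ∧ W 0 = b := by
  -- an enlarged positive radius
  set R : ℝ := max R₁ 1 with hR_def
  have hR0 : 0 < R := lt_of_lt_of_le one_pos (le_max_right _ _)
  have hR1 : R₁ ≤ R := le_max_left _ _
  have hVh : ∀ x : E3, R < ‖x‖ → HarmonicAt V x := fun x hx ↦ hV x (lt_of_le_of_lt hR1 hx)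
  -- the cut-off function `W₀ = (1 - θ) V`
  have h01 : (0 : ℝ) ≤ R + 1 := by linarith
  have h12 : R + 1 < R + 2 := by linarith
  set W₀ : E3 → ℝ := fun x ↦ (1 - radialCutoff (R + 1) (R + 2) x) * V x with hW₀_def
  have hWV : ∀ x : E3, R + 2 < ‖x‖ → W₀ =ᶠ[𝓝 x] V := fun x hx ↦ by
    filter_upwards [radialCutoff_eventuallyEq_zero (E := E3) h01 h12 hx] with y hy
    simp only [hW₀_def, hy, sub_zero, one_mul]
  have hWz : ∀ x : E3, ‖x‖ < R + 1 → W₀ =ᶠ[𝓝 x] fun _ ↦ (0 : ℝ) := fun x hx ↦ by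
    filter_upwards [radialCutoff_eventuallyEq_one (E := E3) h01 h12 hx] with y hy
    simp only [hW₀_def, hy, sub_self, zero_mul]
  have hW2 : ContDiff ℝ 2 W₀ := by
    refine contDiff_iff_contDiffAt.2 fun x ↦ ?_
    by_cases hx : R < ‖x‖
    · exact ((contDiff_const.sub
        (radialCutoff_contDiff (E' := E3) (R + 1) (R + 2))).contDiffAt).mul (hVh x hx).1
    · have hx' := not_lt.1 hx
      exact (contDiffAt_const (c := (0 : ℝ))).congr_of_eventuallyEq (hWz x (by linarith))
  have hΔW : ∀ x : E3, R + 2 < ‖x‖ → (Δ W₀) x = 0 := fun x hx ↦ by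
    rw [(laplacian_congr_nhds (hWV x hx)).eq_of_nhds]
    exact (hVh x (by linarith)).2.eq_of_nhds
  have hWlim : Tendsto W₀ (cobounded E3) (𝓝 0) := by
    refine hV0.congr' ?_
    filter_upwards [eventually_cobounded_le_norm (R + 2)] with y hy
    show V y = (1 - radialCutoff (R + 1) (R + 2) y) * V y
    rw [radialCutoff_eq_zero h01 h12 hy, sub_zero, one_mul]
  -- Green's representation of `W₀`, the density `f = ΔW₀` and the far field
  have hrep := eq_integral_newtonKernel_mul_laplacian hW2 hΔW hWlim
  set S : ℝ := R + 2 with hS_def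
  have hS0 : 0 < S := by rw [hS_def]; linarith
  set f : E3 → ℝ := Δ W₀ with hf_def
  have hfc : Continuous f := continuous_laplacian hW2
  have hfS : ∀ z : E3, S < ‖z‖ → f z = 0 := hΔW
  have hfcs : HasCompactSupport f := by
    refine HasCompactSupport.intro (isCompact_closedBall (0 : E3) S) fun z hz ↦ hfS z ?_
    rwa [mem_closedBall_zero_iff, not_le] at hz
  have hexp := newtonPotential_sub_isBigO hfc hS0.le hfS
  set b : ℝ := -(4 * π)⁻¹ * ∫ z, f z with hb_def
  -- the weighted density and the restricted measure
  set F : E3 → ℝ := fun z ↦ -(4 * π)⁻¹ * f z with hF_def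
  set ν : Measure E3 := volume.restrict (closedBall (0 : E3) S) with hν_def
  have hFi : Integrable F ν :=
    ((hfc.integrable_of_hasCompactSupport hfcs).const_mul _).restrict
  have hm : AEStronglyMeasurable (fun z : E3 ↦ z) ν := aestronglyMeasurable_id
  have hmR : ∀ᵐ z ∂ν, ‖z‖ ≤ S := by
    filter_upwards [ae_restrict_mem (measurableSet_closedBall (x := (0 : E3)) (ε := S))]
      with z hz
    exact mem_closedBall_zero_iff.1 hz
  -- the smooth kernel `A(y, z) = (floor_{1/8} (1 - 2⟨y,z⟩ + |y|²|z|²))^{-1/2}`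
  set Q : E3 × E3 → ℝ := fun p ↦ 1 - 2 * ⟪p.1, p.2⟫ + ‖p.1‖ ^ 2 * ‖p.2‖ ^ 2 with hQ_def
  have hQ_apply : ∀ y z : E3, Q (y, z) = 1 - 2 * ⟪y, z⟫ + ‖y‖ ^ 2 * ‖z‖ ^ 2 := fun y z ↦ rfl
  have hQs : ContDiff ℝ ∞ Q :=
    (contDiff_const.sub (contDiff_const.mul (contDiff_fst.inner ℝ contDiff_snd))).add
      ((contDiff_fst.norm_sq ℝ).mul (contDiff_snd.norm_sq ℝ))
  have hm8 : (0 : ℝ) < 1 / 8 := by norm_num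
  set A : E3 × E3 → ℝ := fun p ↦ (Newtonian.smoothFloor (1 / 8) (Q p)) ^ (-(1 / 2 : ℝ))
    with hA_def
  have hfloor_pos : ∀ p : E3 × E3, 0 < Newtonian.smoothFloor (1 / 8) (Q p) := fun p ↦
    lt_of_lt_of_le hm8 (Newtonian.le_smoothFloor hm8 _)
  have hA : ContDiff ℝ ∞ A :=
    ((Newtonian.contDiff_smoothFloor (1 / 8) (k := ⊤)).comp hQs).rpow_const_of_ne
      fun p ↦ (hfloor_pos p).ne'
  -- where the quadratic form exceeds `1/4` the floor is inactive
  have hAQ : ∀ y z : E3, ‖y‖ * ‖z‖ < 1 / 2 → A (y, z) = (Q (y, z)) ^ (-(1 / 2 : ℝ)) := by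
    intro y z hyz
    have hq : 1 / 4 < Q (y, z) := one_quarter_lt_inversionQuad hyz
    show (Newtonian.smoothFloor (1 / 8) (Q (y, z))) ^ (-(1 / 2 : ℝ)) = (Q (y, z)) ^ (-(1 / 2 : ℝ))
    rw [Newtonian.smoothFloor_eq_self hm8 (by linarith : 2 * (1 / 8) ≤ Q (y, z))]
  -- the Kelvin transform, extended: `W(y) = ∫ A(y, z) F(z) dν(z)`
  set W : E3 → ℝ := fun y ↦ ∫ z, A (y, z) * F z ∂ν with hW_def
  have hWs : ContDiff ℝ ∞ W := contDiff_integral_kernel_mul_real hA hm hmR hFi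
  -- the radius `ρ = 1/(2S)`
  set ρ : ℝ := (2 * S)⁻¹ with hρ_def
  have hρ0 : 0 < ρ := by positivity
  have hρS' : ρ ≤ S⁻¹ := by rw [hρ_def]; exact inv_anti₀ hS0 (by linarith)
  have hρS : ρ * S = 1 / 2 := by rw [hρ_def]; field_simp
  have hyz_small : ∀ y z : E3, ‖y‖ < ρ → ‖z‖ ≤ S → ‖y‖ * ‖z‖ < 1 / 2 := by
    intro y z hy hz
    calc ‖y‖ * ‖z‖ ≤ ‖y‖ * S := mul_le_mul_of_nonneg_left hz (norm_nonneg _)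
      _ < ρ * S := mul_lt_mul_of_pos_right hy hS0
      _ = 1 / 2 := hρS
  refine ⟨W, ρ, b, hWs, hρ0, ?_, ?_, ?_, ?_⟩
  · -- the identity with the Kelvin transform on the punctured ball
    intro y hy hyρ
    have hy0 : 0 < ‖y‖ := norm_pos_iff.2 hy
    have hxn : ‖(‖y‖ ^ 2)⁻¹ • y‖ = ‖y‖⁻¹ := by
      rw [norm_smul, Real.norm_eq_abs, abs_inv, abs_of_nonneg (by positivity : (0 : ℝ) ≤ ‖y‖ ^ 2),
        pow_two, mul_inv, mul_assoc, inv_mul_cancel₀ hy0.ne', mul_one]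
    have hxS : S < ‖(‖y‖ ^ 2)⁻¹ • y‖ := by
      rw [hxn]
      exact (lt_inv_comm₀ hS0 hy0).2 (lt_of_lt_of_le hyρ hρS')
    have hxR : R + 2 < ‖(‖y‖ ^ 2)⁻¹ • y‖ := hxS
    have hVx : V ((‖y‖ ^ 2)⁻¹ • y) = W₀ ((‖y‖ ^ 2)⁻¹ • y) := ((hWV _ hxR).eq_of_nhds).symm
    rw [hVx, hrep ((‖y‖ ^ 2)⁻¹ • y)]
    -- `∫ Γ(x - z) f(z) dz` over `ℝ³` equals the integral over the ball `|z| ≤ S`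
    have hball : (∫ z, newtonKernel ((‖y‖ ^ 2)⁻¹ • y - z) * f z) =
        ∫ z in closedBall (0 : E3) S, newtonKernel ((‖y‖ ^ 2)⁻¹ • y - z) * f z := by
      refine (setIntegral_eq_integral_of_forall_compl_eq_zero fun z hz ↦ ?_).symm
      rw [hfS z (by rwa [mem_closedBall_zero_iff, not_le] at hz), mul_zero]
    rw [hball, ← integral_const_mul]
    refine setIntegral_congr_fun measurableSet_closedBall fun z hz ↦ ?_
    have hzS : ‖z‖ ≤ S := mem_closedBall_zero_iff.1 hz
    have hsmall := hyz_small y z hyρ hzS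
    have hq : 0 < 1 - 2 * ⟪y, z⟫ + ‖y‖ ^ 2 * ‖z‖ ^ 2 :=
      lt_trans (by norm_num) (one_quarter_lt_inversionQuad hsmall)
    show A (y, z) * (-(4 * π)⁻¹ * f z) = ‖y‖⁻¹ * (newtonKernel ((‖y‖ ^ 2)⁻¹ • y - z) * f z)
    rw [← mul_assoc ‖y‖⁻¹, inv_norm_mul_newtonKernel_inversion_sub hy z hq, hAQ y z hsmall,
      hQ_apply]
    ring
  · -- harmonicity on the ball (Kelvin's theorem near the origin)
    intro y hy
    rw [mem_ball_zero_iff] at hy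
    refine ⟨(contDiff_infty.1 hWs 2).contDiffAt, ?_⟩
    filter_upwards [isOpen_ball.mem_nhds (mem_ball_zero_iff.2 hy)] with y' hy'
    rw [mem_ball_zero_iff] at hy'
    show (Δ W) y' = 0
    rw [hW_def, laplacian_integral_kernel_mul_real hA hm hmR hFi y']
    refine integral_eq_zero_of_ae ?_
    filter_upwards [hmR] with z hz
    show kernelLaplacian A (y', z) * F z = 0
    rw [← laplacian_curry_eq_kernelLaplacian hA y' z]
    -- near `y'` the kernel is the un-floored one, which is harmonic in the first variable
    have hopen : IsOpen {w : E3 | ‖w‖ * ‖z‖ < 1 / 2} :=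
      isOpen_lt (continuous_norm.mul continuous_const) continuous_const
    have hsmall := hyz_small y' z hy' hz
    have hev : (fun Y : E3 ↦ A (Y, z)) =ᶠ[𝓝 y']
        fun Y : E3 ↦ ((1 - 2 * ⟪Y, z⟫ + ‖Y‖ ^ 2 * ‖z‖ ^ 2) ^ (-(1 / 2 : ℝ)) : ℝ) := by
      filter_upwards [hopen.mem_nhds hsmall] with Y hY
      rw [hAQ Y z hY, hQ_apply]
    rw [(laplacian_congr_nhds hev).eq_of_nhds, laplacian_inversionKernel_eq_zero hsmall, zero_mul]
  · -- the expansion `V = b/|x| + O(|x|⁻²)` at infinity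
    unfold HasHarmonicExpansion
    refine hexp.congr' ?_ EventuallyEq.rfl
    filter_upwards [eventually_cobounded_le_norm (R + 3)] with x hx
    have hWx : W₀ x = V x := (hWV x (by linarith)).eq_of_nhds
    rw [← hrep x, hWx, hb_def]
    ring
  · -- the value at the origin: `W(0) = -(4π)⁻¹ ∫ f = b`
    have hA0 : ∀ z : E3, A (0, z) = 1 := fun z ↦ by
      rw [hAQ 0 z (by rw [norm_zero, zero_mul]; norm_num), hQ_apply]
      simp
    have hint : (∫ z, f z ∂ν) = ∫ z, f z := by
      rw [hν_def]
      exact setIntegral_eq_integral_of_forall_compl_eq_zero fun z hz ↦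
        hfS z (by rwa [mem_closedBall_zero_iff, not_le] at hz)
    rw [hW_def]
    show (∫ z, A (0, z) * F z ∂ν) = b
    simp_rw [hA0, one_mul, hF_def]
    rw [integral_const_mul, hint, hb_def]

end Literature.Geometry.Lorentzian

end
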